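import Summits.HubbardSuperconductivity.HubbardSuperconductivity.Theorems.AnisotropyChordSpinMonotoneTwoMagnonEdgeTransitive
import Literature.MathematicalPhysics.QuantumLattice.HeisenbergWindowCertificate

/-!
# Route `AnisotropyChord`: `M_Δ` IN THE TWO-MAGNON SECTOR FOR EVERY TORUS — the discrete tori
# `(ℤ/Lℤ)^d` are edge-transitive, so the rung TM-VT (`twoMagnon_condensate_monotone_of_edgeTransitive`)
# applies (bears on `FerroSideChord` stmt-19089, `Concavity` stmt-8150, `…SpinMonotoneDefs`)

* `torusGraph_isEdgeTransitive` — the nearest-neighbour torus graph `torusGraph d L` is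
  EDGE-TRANSITIVE (`Literature…IsEdgeTransitive`): an edge `{a, a ± eᵢ}` is carried to `{0, eᵢ}` by the
  affine automorphism `y ↦ ±y ∓ a` (`torusAff`, `torusGraph_adj_torusAff`) and `eᵢ` to `eⱼ` by the
  coordinate transposition (`torusGraph_adj_comp_perm`, `single_comp_perm`).
* `torusTwoMagnon_condensate_monotone` — **`M_Δ` (`TorusCondensateMonotone`) in the two-magnon
  sector `S^z_tot = L²/2 − 2` of EVERY square torus `torusGraph 2 L`**: for `Δ₁ ≤ Δ₂ ≤ 1` and
  normalised sector ground states of `xxzHamiltonian 1 (torusGraph 2 L) (−1) Δ`, `Λ(ψ₁) ≤ Λ(ψ₂)`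
  (no lower bound on `Δ₁`; the torus is connected, vertex-transitive and edge-transitive);
  `torusTwoMagnon_condensate_monotone_anyDim` — the same on `torusGraph d L` for every `d`.

Previously in the tree: `M_Δ` for `L ≤ 2` in all sectors (`torusCondensateMonotone_of_le_two`) and the
one-magnon slice on every vertex-transitive graph (`OneMagnon.vertexTransitive_oneMagnon_slice`); the
theory seat (`hubbard-h0-rotor-theory-1`, cycle 4) had the two-magnon torus statement on paper via
`w′(σ) ≤ 0` (one contact orbit).  No definition is introduced.
-/

set_option linter.dupNamespace false

noncomputable section

namespace Summit.HubbardSuperconductivity.HubbardSuperconductivity.Theorems.AnisotropyChord.TwoMagnon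

open Matrix Complex Finset
open Literature.MathematicalPhysics.QuantumLattice Literature.Probability.LatticeModels
open Literature.Combinatorics.SimpleGraph (IsVertexTransitive)
open Literature.Combinatorics.SimpleGraph.LovaszThetaEdgeTransitive (IsEdgeTransitive)

/-! ### The torus graph is edge-transitive -/

/-- Every edge `(a, b)` of the torus graph is carried by a graph automorphism to `(0, eᵢ)` for some
axis `i` (`y ↦ y − a` if `b = a + eᵢ`, `y ↦ −y + a` if `a = b + eᵢ`). [folklore] -/
theorem exists_aut_apply_eq_zero_single {d L : ℕ} [NeZero L] {a b : TorusSite d L}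
    (hab : (torusGraph d L).Adj a b) :
    ∃ (π : TorusSite d L ≃ TorusSite d L) (i : Fin d),
      (∀ x y, (torusGraph d L).Adj (π x) (π y) ↔ (torusGraph d L).Adj x y) ∧
      π a = 0 ∧ π b = Pi.single i 1 := by
  rw [torusGraph_adj_iff] at hab
  obtain ⟨-, ⟨i, hi⟩ | ⟨i, hi⟩⟩ := hab
  · refine ⟨torusAff 1 (-a), i, fun x y => torusGraph_adj_torusAff 1 (-a) x y, ?_, ?_⟩
    · funext k
      simp [torusAff_apply]
    · funext k
      rw [torusAff_apply, hi]
      simp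
  · refine ⟨torusAff (-1) a, i, fun x y => torusGraph_adj_torusAff (-1) a x y, ?_, ?_⟩
    · funext k
      simp [torusAff_apply]
    · funext k
      rw [torusAff_apply, hi]
      simp

/-- **The torus graph `(ℤ/Lℤ)^d` is edge-transitive.** [folklore] -/
theorem torusGraph_isEdgeTransitive (d L : ℕ) [NeZero L] : IsEdgeTransitive (torusGraph d L) := by
  intro a b c e hab hce
  obtain ⟨π₁, i, hπ₁, ha, hb⟩ := exists_aut_apply_eq_zero_single hab
  obtain ⟨π₂, j, hπ₂, hc, he⟩ := exists_aut_apply_eq_zero_single hce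
  -- the coordinate transposition `x ↦ x ∘ swap i j`
  set S : TorusSite d L ≃ TorusSite d L :=
    { toFun := fun x => x ∘ Equiv.swap i j
      invFun := fun x => x ∘ Equiv.swap i j
      left_inv := fun x => by funext k; simp [Equiv.swap_apply_self]
      right_inv := fun x => by funext k; simp [Equiv.swap_apply_self] } with hSdef
  have hS : ∀ x y, (torusGraph d L).Adj (S x) (S y) ↔ (torusGraph d L).Adj x y :=
    fun x y => torusGraph_adj_comp_perm L (Equiv.swap i j) x y
  have hS0 : S 0 = 0 := by funext k; rfl
  have hSi : S (Pi.single i 1) = Pi.single j 1 := by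
    show ((Pi.single i (1 : ZMod L) : TorusSite d L) ∘ Equiv.swap i j) = Pi.single j 1
    rw [single_comp_perm L (Equiv.swap i j) i, Equiv.symm_swap, Equiv.swap_apply_left]
  -- `Φ = π₂⁻¹ ∘ S ∘ π₁`
  set Φ : TorusSite d L ≃ TorusSite d L := (π₁.trans S).trans π₂.symm with hΦdef
  have hΦ : ∀ x y, (torusGraph d L).Adj (Φ x) (Φ y) ↔ (torusGraph d L).Adj x y := by
    intro x y
    have h2 : ∀ x y, (torusGraph d L).Adj (π₂.symm x) (π₂.symm y) ↔ (torusGraph d L).Adj x y := by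
      intro x y
      have h := hπ₂ (π₂.symm x) (π₂.symm y)
      rw [Equiv.apply_symm_apply, Equiv.apply_symm_apply] at h
      exact h.symm
    simp only [hΦdef, Equiv.trans_apply]
    rw [h2, hS, hπ₁]
  refine ⟨{ toEquiv := Φ, map_rel_iff' := fun {x y} => hΦ x y }, Or.inl ⟨?_, ?_⟩⟩
  · show Φ a = c
    simp only [hΦdef, Equiv.trans_apply, ha, hS0]
    rw [Equiv.symm_apply_eq, hc]
  · show Φ b = e
    simp only [hΦdef, Equiv.trans_apply, hb, hSi]
    rw [Equiv.symm_apply_eq, he]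

/-! ### `M_Δ` in the two-magnon sector of every torus -/

/-- **`M_Δ` in the two-magnon sector for every torus, any dimension**: on `torusGraph d L`
(connected, vertex-transitive, edge-transitive), in the sector `S^z_tot = |V|/2 − 2`, the condensate
of normalised sector ground states of `xxzHamiltonian 1 (torusGraph d L) (−1) Δ` is non-decreasing
from `Δ₁` to `Δ₂` whenever `Δ₁ ≤ Δ₂ ≤ 1`. [folklore] -/
theorem torusTwoMagnon_condensate_monotone_anyDim (d L : ℕ) [NeZero L] {Δ₁ Δ₂ : ℝ} (h12 : Δ₁ ≤ Δ₂)
    (h2 : Δ₂ ≤ 1) {ψ₁ ψ₂ : TensorIndex (TorusSite d L) 2 → ℂ}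
    (g₁m : ψ₁ ∈ spinZSector (Λ := TorusSite d L) 1 ((Fintype.card (TorusSite d L) : ℝ) / 2 - 2))
    (g₁n : star ψ₁ ⬝ᵥ ψ₁ = 1)
    (g₁e : xxzHamiltonian 1 (torusGraph d L) (-1) Δ₁ *ᵥ ψ₁ =
      ((lowestEnergyInSector 1 (xxzHamiltonian 1 (torusGraph d L) (-1) Δ₁)
        ((Fintype.card (TorusSite d L) : ℝ) / 2 - 2) : ℝ) : ℂ) • ψ₁)
    (g₂m : ψ₂ ∈ spinZSector (Λ := TorusSite d L) 1 ((Fintype.card (TorusSite d L) : ℝ) / 2 - 2))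
    (g₂n : star ψ₂ ⬝ᵥ ψ₂ = 1)
    (g₂e : xxzHamiltonian 1 (torusGraph d L) (-1) Δ₂ *ᵥ ψ₂ =
      ((lowestEnergyInSector 1 (xxzHamiltonian 1 (torusGraph d L) (-1) Δ₂)
        ((Fintype.card (TorusSite d L) : ℝ) / 2 - 2) : ℝ) : ℂ) • ψ₂) :
    (star ψ₁ ⬝ᵥ (((∑ x, onSite x (spinRaise 1)) * (∑ y, onSite y (spinLower 1)) :
        Op (TorusSite d L) 2) *ᵥ ψ₁)).re ≤
      (star ψ₂ ⬝ᵥ (((∑ x, onSite x (spinRaise 1)) * (∑ y, onSite y (spinLower 1)) :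
        Op (TorusSite d L) 2) *ᵥ ψ₂)).re :=
  twoMagnon_condensate_monotone_of_edgeTransitive (torusGraph d L) (torusGraph_connected_of_proj d L)
    (torusGraph_isVertexTransitive d L) (torusGraph_isEdgeTransitive d L) h12 h2
    g₁m g₁n g₁e g₂m g₂n g₂e

/-- **`M_Δ` (`TorusCondensateMonotone` of `…SpinMonotoneDefs`) in the two-magnon sector
`S^z_tot = L²/2 − 2` of EVERY square torus `(ℤ/Lℤ)²`** — the statement of the conjecture verbatim for
this sector value (with `|V|/2 − 2` for `L²/2 − 2`), all `L`, all `−1 ≤ Δ₁ ≤ Δ₂ ≤ 1`. [folklore] -/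
theorem torusTwoMagnon_condensate_monotone :
    ∀ (L : ℕ) [NeZero L] (Δ₁ Δ₂ : ℝ), -1 ≤ Δ₁ → Δ₁ ≤ Δ₂ → Δ₂ ≤ 1 →
      ∀ ψ₁ ψ₂ : TensorIndex (TorusSite 2 L) 2 → ℂ,
        ψ₁ ∈ spinZSector (Λ := TorusSite 2 L) 1 ((Fintype.card (TorusSite 2 L) : ℝ) / 2 - 2) →
        star ψ₁ ⬝ᵥ ψ₁ = 1 →
          xxzHamiltonian 1 (torusGraph 2 L) (-1) Δ₁ *ᵥ ψ₁ =
            ((lowestEnergyInSector 1 (xxzHamiltonian 1 (torusGraph 2 L) (-1) Δ₁)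
              ((Fintype.card (TorusSite 2 L) : ℝ) / 2 - 2) : ℝ) : ℂ) • ψ₁ →
        ψ₂ ∈ spinZSector (Λ := TorusSite 2 L) 1 ((Fintype.card (TorusSite 2 L) : ℝ) / 2 - 2) →
        star ψ₂ ⬝ᵥ ψ₂ = 1 →
          xxzHamiltonian 1 (torusGraph 2 L) (-1) Δ₂ *ᵥ ψ₂ =
            ((lowestEnergyInSector 1 (xxzHamiltonian 1 (torusGraph 2 L) (-1) Δ₂)
              ((Fintype.card (TorusSite 2 L) : ℝ) / 2 - 2) : ℝ) : ℂ) • ψ₂ →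
        (star ψ₁ ⬝ᵥ (((∑ x, onSite x (spinRaise 1)) * (∑ y, onSite y (spinLower 1)) :
            Op (TorusSite 2 L) 2) *ᵥ ψ₁)).re
          ≤ (star ψ₂ ⬝ᵥ (((∑ x, onSite x (spinRaise 1)) * (∑ y, onSite y (spinLower 1)) :
            Op (TorusSite 2 L) 2) *ᵥ ψ₂)).re :=
  fun L _ _ _ _ h12 h2 _ _ g₁m g₁n g₁e g₂m g₂n g₂e =>
    torusTwoMagnon_condensate_monotone_anyDim 2 L h12 h2 g₁m g₁n g₁e g₂m g₂n g₂e

end Summit.HubbardSuperconductivity.HubbardSuperconductivity.Theorems.AnisotropyChord.TwoMagnon
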